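/-
HONEST FRAMING: certified error envelopes and provably optimal rounding/accumulation schemes for
low-precision formats under stated cost models; every table by two implementations; no hardware
or vendor claims.
-/
import Mathlib.Tactic.Linarith
import Mathlib.Tactic.LinearCombination
import Mathlib.Tactic.NormNum
import Mathlib.Tactic.Ring
import Mathlib.Tactic.Positivity

/-!
# The demotion law (Theorem T8), part 12-1: the branch certificates of the Φ-hierarchy AT AN ARBITRARY LEVEL AND WEIGHT (pure arithmetic)

Part 12 generalises Part 11 (the top-level e-side at the weight `ρ = u`, HOME E-SIDE-TOPLEVEL.md)
to the `E`-rows of EVERY level with the level's own weight: for a 'half' bit at any exponent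
`h ≥ -q` and every weight `0 ≤ ρ ≤ 2^h`,

  `E(S; h, ρ):    2·BR({-1} ∪ S) ≤ (1-ρ)·BR({0} ∪ S) + (1+ρ)·BR({h} ∪ S)`,        `S ⊆ [h+1, -2]`,
  `Φ(S; e, h, ρ): 2·BR({-1} ∪ S) ≤ (1-ρ)·BR({0} ∪ S) + BR({e-q, h} ∪ S) + ρ·BR({e-q} ∪ S)`

(`h = -q`, `ρ = u` is Part 11).  The node step is the same scheme (same options, same rows: the
injected bit stays at `top - q`, only the real bit `h` and the weights move); this file proves its
eight branch certificates with EXPLICIT hand multipliers (lean seat gen 15, CONJECTURE-D-NODESTEP.md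
§G15.2) — all of the form "weights `(1-ρ), 1, ρ` on the right-hand options + LEMMA B1 at the weight
`ρ`", where B1(ρ): `2Y₁ ≤ (1-ρ)Y₀ + (1+ρ)Y_J` is `(t-ρ+ρt)/t ·` [(MC) + (M)] `+ ρ/t ·` [gap convexity]
(valid while `ρ(1-t) ≤ t`).  Box: `0 ≤ ρ ≤ 1`, `ρ(1-t) ≤ t` (resp. `w`, `τ`), and for the two
`K = ∅` branches `ρ ≤ η + ρ t u` resp. `ρ ≤ η`, `ρ ≤ τ` (`η = 2^h`).
-/

namespace Summit.Ventures.CertifiedArithmetic.LowPrec.Opt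

/-- LEMMA B1 AT THE WEIGHT `ρ` (scaled by `t`): from (MC) `2Y₁ ≤ Y₀ + Z`, (M) `Z ≤ Y_J` and gap
convexity `(2-2t)Y₁ ≤ Y_J + (1-2t)Y₀`: `2Y₁ ≤ (1-ρ)Y₀ + (1+ρ)Y_J` whenever `ρ(1-t) ≤ t`, `t > 0`. -/
theorem b1_at_weight {ρ t Y1 Y0 YJ Z : ℚ} (hρ0 : 0 ≤ ρ) (ht0 : 0 < t) (hs : ρ ≤ t + ρ * t)
    (rMC : 2 * Y1 ≤ Y0 + Z) (rGC : 0 ≤ (-2 + 2 * t) * Y1 + YJ + (1 - 2 * t) * Y0) (rM : Z ≤ YJ) :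
    2 * Y1 ≤ (1 - ρ) * Y0 + (1 + ρ) * YJ := by
  have hc : 0 ≤ t - ρ + ρ * t := by linarith
  have f1 := mul_le_mul_of_nonneg_left rMC hc
  have f2 := mul_le_mul_of_nonneg_left rM hc
  have f3 := mul_nonneg hρ0 rGC
  have key : t * (2 * Y1) ≤ t * ((1 - ρ) * Y0 + (1 + ρ) * YJ) := by
    linear_combination f1 + f2 + f3
  exact le_of_mul_le_mul_left key ht0

/-! ## The four `E`-branches -/

/-- `E(S; h, ρ)`, kept set `K = S`: the induction hypothesis on the major child. -/
theorem eRowL_all {ρ u t NS NR A1 A0 AH Z0 : ℚ} (hρ0 : 0 ≤ ρ) (hρ1 : ρ ≤ 1) (hu0 : 0 ≤ u)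
    (hs : ρ ≤ t + ρ * t) (o1 : 1 + (A0 + u * Z0) ≤ NS) (o2 : t + (AH + t * u * Z0) ≤ NR)
    (ih : 2 * A1 ≤ (1 - ρ) * A0 + (1 + ρ) * AH) (hZ : 0 ≤ Z0) :
    1 + (2 * A1 + u * Z0) ≤ (1 - ρ) * NS + (1 + ρ) * NR := by
  have f1 := mul_le_mul_of_nonneg_left o1 (sub_nonneg.2 hρ1)
  have f2 := mul_le_mul_of_nonneg_left o2 (by linarith : 0 ≤ 1 + ρ)
  have hsl : 0 ≤ (t + ρ * t - ρ) * (1 + u * Z0) := mul_nonneg (by linarith) (by nlinarith)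
  linear_combination f1 + f2 + ih + hsl

/-- `E(S; h, ρ)`, kept set `K = ∅`: options `1 + A₀₀ + Y_{S0} ≤ N_S` (`Y_{S0} = BR_Y({-q} ∪ S)`),
`t + Y_S + η A_{0s} ≤ N_h` (`η = 2^h`, `A_{0s} = BR_X{s₁-q-h, 0}`), `t + Y_{Sh} + t u A₀₀ ≤ N_h`
(`Y_{Sh} = BR_Y({h} ∪ S)`), weights `1-ρ, 1, ρ`; rows (M) `A₀₀ ≤ A_{0s}`, (MC) `2Y_{S1} ≤ Y_{S0} + Y_S`,
(M) `Y_{S0} ≤ Y_{Sh}`. -/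
theorem eRowL_empty {ρ u t η NS NR A00 A0s YS1 YS0 YS YSh : ℚ} (hρ0 : 0 ≤ ρ) (hρ1 : ρ ≤ 1)
    (hη0 : 0 ≤ η) (hs : ρ ≤ t + ρ * t) (hη : ρ ≤ η + ρ * t * u) (hA : 0 ≤ A00)
    (o1 : 1 + (A00 + YS0) ≤ NS) (o2 : t + (YS + η * A0s) ≤ NR) (o3 : t + (YSh + t * u * A00) ≤ NR)
    (rMa : A00 ≤ A0s) (rMC : 2 * YS1 ≤ YS0 + YS) (rMb : YS0 ≤ YSh) :
    1 + (A00 + 2 * YS1) ≤ (1 - ρ) * NS + (1 + ρ) * NR := by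
  have f1 := mul_le_mul_of_nonneg_left o1 (sub_nonneg.2 hρ1)
  have f3 := mul_le_mul_of_nonneg_left o3 hρ0
  have g1 := mul_le_mul_of_nonneg_left rMa hη0
  have g2 := mul_le_mul_of_nonneg_left rMb hρ0
  have hs1 : 0 ≤ t + ρ * t - ρ := by linarith
  have hs2 : 0 ≤ A00 * (η - ρ + ρ * t * u) := mul_nonneg hA (by linarith)
  linear_combination f1 + o2 + f3 + rMC + g2 + g1 + hs1 + hs2

/-- `E(S; h, ρ)`, kept set `K ∋ max S`, complement `C ≠ ∅`: options `1 + A₀ + Y₀ ≤ N_S`,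
`t + A_H + Y_J ≤ N_h` (`A_H = BR_X({h} ∪ K)`), weights `1-ρ, 1+ρ`; rows `E(K; h, ρ)` on `X` and B1 at
the weight `ρ` on `Y`. -/
theorem eRowL_top {ρ t NS NR A1 A0 AH Y1 Y0 YJ Z : ℚ} (hρ0 : 0 ≤ ρ) (hρ1 : ρ ≤ 1) (ht0 : 0 < t)
    (hs : ρ ≤ t + ρ * t) (o1 : 1 + (A0 + Y0) ≤ NS) (o2 : t + (AH + YJ) ≤ NR)
    (rE : 2 * A1 ≤ (1 - ρ) * A0 + (1 + ρ) * AH) (rMC : 2 * Y1 ≤ Y0 + Z)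
    (rGC : 0 ≤ (-2 + 2 * t) * Y1 + YJ + (1 - 2 * t) * Y0) (rM : Z ≤ YJ) :
    1 + (2 * A1 + 2 * Y1) ≤ (1 - ρ) * NS + (1 + ρ) * NR := by
  have f1 := mul_le_mul_of_nonneg_left o1 (sub_nonneg.2 hρ1)
  have f2 := mul_le_mul_of_nonneg_left o2 (by linarith : 0 ≤ 1 + ρ)
  have b1 := b1_at_weight hρ0 ht0 hs rMC rGC rM
  have hs1 : 0 ≤ t + ρ * t - ρ := by linarith
  linear_combination f1 + f2 + rE + b1 + hs1

/-- `E(S; h, ρ)`, kept set `K` with `max S ∉ K ≠ ∅`: options `1 + A₀ + Y₀ ≤ N_S`, `t + Z + A_P ≤ N_h`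
(`A_P = BR_X({max S - q, h} ∪ K)`), `t + Y_h + A_J ≤ N_h` (`Y_h = BR_Y({h} ∪ C)`,
`A_J = BR_X({max S - q} ∪ K)`), weights `1-ρ, 1, ρ`; rows `Φ(K; max S, h, ρ)` on `X`, (MC) and (M)
`Y₀ ≤ Y_h` on `Y`. -/
theorem eRowL_low {ρ t NS NR A1 A0 AP AJ Y1 Y0 Yh Z : ℚ} (hρ0 : 0 ≤ ρ) (hρ1 : ρ ≤ 1)
    (hs : ρ ≤ t + ρ * t) (o1 : 1 + (A0 + Y0) ≤ NS) (o2 : t + (Z + AP) ≤ NR) (o3 : t + (Yh + AJ) ≤ NR)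
    (rPhi : 2 * A1 ≤ (1 - ρ) * A0 + AP + ρ * AJ) (rMC : 2 * Y1 ≤ Y0 + Z) (rM : Y0 ≤ Yh) :
    1 + (2 * A1 + 2 * Y1) ≤ (1 - ρ) * NS + (1 + ρ) * NR := by
  have f1 := mul_le_mul_of_nonneg_left o1 (sub_nonneg.2 hρ1)
  have f3 := mul_le_mul_of_nonneg_left o3 hρ0
  have g := mul_le_mul_of_nonneg_left rM hρ0
  have hs1 : 0 ≤ t + ρ * t - ρ := by linarith
  linear_combination f1 + o2 + f3 + rPhi + rMC + g + hs1

/-! ## The four `Φ`-branches -/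

/-- `Φ(S; e, h, ρ)`, kept set `K = S`: the induction hypothesis. -/
theorem phiL_all {ρ u w NS N2 N3 A1 A0 A2 A3 Z0 : ℚ} (hρ0 : 0 ≤ ρ) (hρ1 : ρ ≤ 1) (hu0 : 0 ≤ u)
    (hs : ρ ≤ w + ρ * w) (o1 : 1 + (A0 + u * Z0) ≤ NS) (o2 : w + (A2 + w * u * Z0) ≤ N2)
    (o3 : w + (A3 + w * u * Z0) ≤ N3) (ih : 2 * A1 ≤ (1 - ρ) * A0 + A2 + ρ * A3) (hZ : 0 ≤ Z0) :
    1 + (2 * A1 + u * Z0) ≤ (1 - ρ) * NS + N2 + ρ * N3 := by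
  have f1 := mul_le_mul_of_nonneg_left o1 (sub_nonneg.2 hρ1)
  have f3 := mul_le_mul_of_nonneg_left o3 hρ0
  have hsl : 0 ≤ (w + ρ * w - ρ) * (1 + u * Z0) := mul_nonneg (by linarith) (by nlinarith)
  linear_combination f1 + o2 + f3 + ih + hsl

/-- `Φ(S; e, h, ρ)`, kept set `K ∋ max S`, complement `C ≠ ∅`: options `1 + A₀ + Y₀ ≤ N_S`,
`w + A₂ + Y_J ≤ N₂`, `w + A₃ + Y_J ≤ N₃`, weights `1-ρ, 1, ρ`; `Φ(K; e, h, ρ)` on `X`, B1 at the weight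
`ρ` on `Y` (gap row with the coefficient `2w`, `w = 2^{max S}`). -/
theorem phiL_top {ρ w NS N2 N3 A1 A0 A2 A3 Y1 Y0 YJ Z : ℚ} (hρ0 : 0 ≤ ρ) (hρ1 : ρ ≤ 1) (hw0 : 0 < w)
    (hs : ρ ≤ w + ρ * w) (o1 : 1 + (A0 + Y0) ≤ NS) (o2 : w + (A2 + YJ) ≤ N2) (o3 : w + (A3 + YJ) ≤ N3)
    (rPhi : 2 * A1 ≤ (1 - ρ) * A0 + A2 + ρ * A3) (rMC : 2 * Y1 ≤ Y0 + Z)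
    (rGC : 0 ≤ (-2 + 2 * w) * Y1 + YJ + (1 - 2 * w) * Y0) (rM : Z ≤ YJ) :
    1 + (2 * A1 + 2 * Y1) ≤ (1 - ρ) * NS + N2 + ρ * N3 := by
  have f1 := mul_le_mul_of_nonneg_left o1 (sub_nonneg.2 hρ1)
  have f3 := mul_le_mul_of_nonneg_left o3 hρ0
  have b1 := b1_at_weight hρ0 hw0 hs rMC rGC rM
  have hs1 : 0 ≤ w + ρ * w - ρ := by linarith
  linear_combination f1 + o2 + f3 + rPhi + b1 + hs1

/-- `Φ(S; e, h, ρ)`, kept set `K` with `max S ∉ K ≠ ∅`: options `1 + A₀ + Y₀ ≤ N_S`,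
`w + Y_E + A_P ≤ N₂`, `w + Y_E + A_J ≤ N₃`, weights `1-ρ, 1, ρ`; `Φ(K; max S, h, ρ)` on `X`, B1 at the
weight `ρ` on `Y` (gap row with the coefficient `2τ`, `τ = 2^e`). -/
theorem phiL_low {ρ w τ NS N2 N3 A1 A0 AP AJ Y1 Y0 YE Z : ℚ} (hρ0 : 0 ≤ ρ) (hρ1 : ρ ≤ 1) (hτ0 : 0 < τ)
    (hsτ : ρ ≤ τ + ρ * τ) (hs : ρ ≤ w + ρ * w) (o1 : 1 + (A0 + Y0) ≤ NS) (o2 : w + (YE + AP) ≤ N2)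
    (o3 : w + (YE + AJ) ≤ N3) (rPhi : 2 * A1 ≤ (1 - ρ) * A0 + AP + ρ * AJ) (rMC : 2 * Y1 ≤ Y0 + Z)
    (rGC : 0 ≤ (-2 + 2 * τ) * Y1 + YE + (1 - 2 * τ) * Y0) (rM : Z ≤ YE) :
    1 + (2 * A1 + 2 * Y1) ≤ (1 - ρ) * NS + N2 + ρ * N3 := by
  have f1 := mul_le_mul_of_nonneg_left o1 (sub_nonneg.2 hρ1)
  have f3 := mul_le_mul_of_nonneg_left o3 hρ0
  have b1 := b1_at_weight hρ0 hτ0 hsτ rMC rGC rM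
  have hs1 : 0 ≤ w + ρ * w - ρ := by linarith
  linear_combination f1 + o2 + f3 + rPhi + b1 + hs1

/-- `Φ(S; e, h, ρ)`, kept set `K = ∅` (the hard branch): options `1 + A₀₀ + Y_{Sq} ≤ N_S`,
`w + Y_S + η A_{JK} ≤ N₂` (`X` gets `{max S - q, e-q, h}`), `w + Y_{Se} + η A_{0s} ≤ N₂` (`X` gets
`{max S - q, h}`), `w + Y_S + τ u A_{KJ} ≤ N₃`, weights `1-ρ, 1 - ρ/τ, ρ/τ, ρ`; rows (MC) `2Y_{S1} ≤
Y_{Sq} + Y_S` and gap convexity on `Y`, (M) `A₀₀ ≤ A_{JK}`, `A₀₀ ≤ A_{0s}` on `X`. -/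
theorem phiL_empty {ρ u w τ η NS N2 N3 A00 AJK A0s AKJ YS1 YSq YS YSe : ℚ} (hρ0 : 0 ≤ ρ) (hρ1 : ρ ≤ 1)
    (hu0 : 0 ≤ u) (hτ0 : 0 < τ) (hρτ : ρ ≤ τ) (hρη : ρ ≤ η) (hs : ρ ≤ w + ρ * w) (hA : 0 ≤ A00)
    (o1 : 1 + (A00 + YSq) ≤ NS) (o2 : w + (YS + η * AJK) ≤ N2) (o3 : w + (YSe + η * A0s) ≤ N2)
    (o4 : w + (YS + τ * u * AKJ) ≤ N3) (rMC : 2 * YS1 ≤ YSq + YS)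
    (rGC : 0 ≤ (-2 + 2 * τ) * YS1 + YSe + (1 - 2 * τ) * YSq) (rM1 : A00 ≤ AJK) (rM2 : A00 ≤ A0s)
    (hn : 0 ≤ AKJ) :
    1 + (A00 + 2 * YS1) ≤ (1 - ρ) * NS + N2 + ρ * N3 := by
  have f1 := mul_le_mul_of_nonneg_left o1 (mul_nonneg hτ0.le (sub_nonneg.2 hρ1))
  have f2 := mul_le_mul_of_nonneg_left o2 (sub_nonneg.2 hρτ)
  have f3 := mul_le_mul_of_nonneg_left o3 hρ0
  have f4 := mul_le_mul_of_nonneg_left o4 (mul_nonneg hτ0.le hρ0)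
  have g1 := mul_le_mul_of_nonneg_left rMC (by nlinarith : 0 ≤ τ - ρ + ρ * τ)
  have g2 := mul_nonneg hρ0 rGC
  have hη0 : 0 ≤ η := hρ0.trans hρη
  have g3 := mul_le_mul_of_nonneg_left rM1 (mul_nonneg (sub_nonneg.2 hρτ) hη0)
  have g4 := mul_le_mul_of_nonneg_left rM2 (mul_nonneg hρ0 hη0)
  have hs1 : 0 ≤ τ * (w + ρ * w - ρ) := mul_nonneg hτ0.le (by linarith)
  have hs2 : 0 ≤ τ * (η - ρ) * A00 := mul_nonneg (mul_nonneg hτ0.le (sub_nonneg.2 hρη)) hA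
  have hs3 : 0 ≤ τ * ρ * (τ * u * AKJ) := mul_nonneg (mul_nonneg hτ0.le hρ0) (mul_nonneg (mul_nonneg hτ0.le hu0) hn)
  have key : τ * (1 + (A00 + 2 * YS1)) ≤ τ * ((1 - ρ) * NS + N2 + ρ * N3) := by
    linear_combination f1 + f2 + f3 + f4 + g1 + g2 + g3 + g4 + hs1 + hs2 + hs3
  exact le_of_mul_le_mul_left key hτ0

end Summit.Ventures.CertifiedArithmetic.LowPrec.Opt
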